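import Summits.Ventures.HodgeRepro2.T5IntertwinerDimension
import Summits.Ventures.HodgeRepro2.T5IsotypicDecomposition

/-!
# The isotypic component through the space of intertwiners

For a continuous finite-dimensional representation `π` of a compact Hausdorff group `G` and a
continuous irreducible `σ` on `W₀`: the multiplicity count `equivCount π σ S` of
`T5MultiplicityGeneral` equals `dim Hom_G(σ, π)` (`equivCount_eq_finrank_intertwiningMap`), so the
isotypic component `V_σ = isotypic π σ` of `T5IsotypicCopies` has dimension
`dim Hom_G(σ, π) · dim σ` (`finrank_isotypic_eq_finrank_intertwiningMap_mul` — the dimension form of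
`V_σ ≅ Hom_G(σ, V) ⊗ σ`) and `dim V_σ = (∫ χ_π · conj χ_σ) · dim σ` in every universe
(`finrank_isotypic_eq_integral_mul'`; `T5IsotypicDecomposition.finrank_isotypic_eq_integral_mul`
had `W₀ : Type`).

Blind lane: Mathlib + own prefix only; no sorry; axioms ⊆ {propext, Classical.choice, Quot.sound}.
-/

namespace Summit.Ventures.HodgeRepro2.T5IsotypicIntertwiners

open T5SchurOrthogonality T5CompleteReducibility T5RestrictionRep T5SchurMathlib
  T5IntertwinerDimension MeasureTheory

variable {G : Type*} [Group G] [TopologicalSpace G] [IsTopologicalGroup G] [MeasurableSpace G]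
  [BorelSpace G] [CompactSpace G] [T2Space G]
variable {V : Type*} [NormedAddCommGroup V] [InnerProductSpace ℂ V] [FiniteDimensional ℂ V]
variable {W₀ : Type*} [NormedAddCommGroup W₀] [InnerProductSpace ℂ W₀] [FiniteDimensional ℂ W₀]

/-- **The multiplicity count is the intertwiner dimension**: for any irreducible internal
decomposition `S` of `V`, `equivCount π σ S = dim Hom_G(σ, π)`. -/
theorem equivCount_eq_finrank_intertwiningMap [Nontrivial W₀] (σ : G →* W₀ →L[ℂ] W₀)
    (hσc : Continuous σ) (hσi : IsIrreducible σ) (π : G →* V →L[ℂ] V) (hπ : Continuous π)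
    (S : Finset (Submodule ℂ V)) (hS : ∀ W ∈ S, IsIrreducibleSubspace π W)
    (hint : DirectSum.IsInternal fun W : S => (W : Submodule ℂ V))
    (hst : ∀ W ∈ S, IsStable π W) :
    T5MultiplicityGeneral.equivCount π σ S hst =
      Module.finrank ℂ ((toRep σ).IntertwiningMap (toRep π)) := by
  classical
  rw [finrank_intertwiningMap_eq_sum σ hσc hσi π hπ S hS hint, Finset.sum_boole, Nat.cast_id]
  unfold T5MultiplicityGeneral.equivCount
  congr 1

/-- **`dim V_σ = dim Hom_G(σ, π) · dim σ`** — the dimension form of `V_σ ≅ Hom_G(σ, V) ⊗ σ`. -/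
theorem finrank_isotypic_eq_finrank_intertwiningMap_mul [Nontrivial W₀] (σ : G →* W₀ →L[ℂ] W₀)
    (hσc : Continuous σ) (hσi : IsIrreducible σ) (π : G →* V →L[ℂ] V) (hπ : Continuous π) :
    Module.finrank ℂ (T5IsotypicCopies.isotypic π σ) =
      Module.finrank ℂ ((toRep σ).IntertwiningMap (toRep π)) * Module.finrank ℂ W₀ := by
  obtain ⟨S, hS, hint⟩ := T5AveragedProjection.exists_isInternal_irreducible_of_compact π hπ
  have hst : ∀ W ∈ S, IsStable π W := fun W hW => (hS W hW).2.1
  rw [T5IsotypicDecomposition.finrank_isotypic_eq_mul π σ S hint hS hst,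
    equivCount_eq_finrank_intertwiningMap σ hσc hσi π hπ S hS hint hst]

/-- **`dim V_σ = (∫ χ_π · conj χ_σ) · dim σ`** in every universe. -/
theorem finrank_isotypic_eq_integral_mul' [Nontrivial W₀] (σ : G →* W₀ →L[ℂ] W₀)
    (hσc : Continuous σ) (hσi : IsIrreducible σ) (π : G →* V →L[ℂ] V) (hπ : Continuous π) :
    (Module.finrank ℂ (T5IsotypicCopies.isotypic π σ) : ℂ) =
      (∫ g, character π g * (starRingEnd ℂ) (character σ g) ∂haarProb G) *
        Module.finrank ℂ W₀ := by
  rw [finrank_isotypic_eq_finrank_intertwiningMap_mul σ hσc hσi π hπ, Nat.cast_mul,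
    finrank_intertwiningMap_eq_integral σ hσc hσi π hπ]

end Summit.Ventures.HodgeRepro2.T5IsotypicIntertwiners
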